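import Summits.NavierStokesRegularity.NavierStokesRegularity.Theorems.RungBlowupCofinal.RungSimilarityVariables
import Literature.Analysis.FluidPDE.PineauVicolRDSSLeray
import Literature.Analysis.FluidPDE.PineauVicolAngularMean
import Literature.Analysis.FluidPDE.SwirlTransportProofs
import Literature.Analysis.FluidPDE.IsometryInvariance
import Literature.Analysis.FluidPDE.AxisymNoSwirlVorticity

/-!
# The forced ROTATING Leray reduction: a steady profile of the co-precessing similarity frame,
# `−νΔV + ½V + ½(z·∇)V + α·J₃V + (V·∇)V + ∇Q = G`, generates Pineau–Vicol's precessing field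
# `pvAnsatz α V` as a classical Navier–Stokes solution on the past FORCED by the co-precessing defect

Circuit seat (ns-blowup-circuit g10), route-independent kernel tools `--supports` crux K1
`RungBlowupCofinal` (stmt-NavierStokesRegularity-19959, helper lane); no definition, no named fact.
This is the one calculus item left owed by `PrecessingLerayLineRungProfile.lean` (p518969, whose
hypothesis `hcl` it discharges) and recorded in HOME/circuit/agl/LERAY-LINE-READING.md §6.

## Contents (all proved; `J₃ = AngularLadder.angGen 2`, `R(θ) = rotZ θ`, `J = rotGen = e₃ × ·`)

* §A rotation calculus about the axis: `rotGen_eq_cross_axis` (`J v = e₃ × v`), the tree's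
  `rotGen_rotZ` (`J R_θ = R_θ J`, `AxisymNoSwirlVorticity`), `rotGen_rotZ_eq`, `rotZ_eq_cos_sin'`, and the chain rule for a rotating curve
  **`hasDerivAt_rotZ_curve`**: `d/ds R_{θ(s)} W(s) = θ′ J R_θ W + R_θ W′`.
* §B the precessing profile `U(s,y) = R(αs) V(R(−αs) y)` of the backward similarity variables:
  **`hasDerivAt_precessing` / `timeDeriv_precessing`**: `∂ₛU(s,y) = α R(αs) (J₃V)(R(−αs)y)` — the
  Coriolis term of the co-precessing frame is the ladder's OWN rotation generator `angGen 2`;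
  joint smoothness `contDiff_uncurry_precessing(_scalar)` (tree `contDiff_rotZ_uncurry`).
* §C **`backwardLeray_precessing`**: the rotating steady system for `(V, Q)` with defect `G` gives a
  classical solution `(U, Q(R(−αs)·))` on ALL of `ℝ × ℝ³` of the backward Leray system (Leray
  drift `rescaledEulerLerayForce 1 U`) forced by the co-rotated defect `R(αs)G(R(−αs)·)` (slices
  are conjugates by `rotZLIE (αs)`: tree `convect/laplacian/gradient/fderiv_conj_linearIsometryEquiv`).
* §D **`isClassicalNSSolutionOn_pvAnsatz_forced`**: back to physical variables through the FORCED
  similarity dictionary `isClassicalNSSolutionOn_Iio_iff_backwardLeray_forced`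
  (`RungSimilarityVariables.lean`, p525350) and the tree's `lerayOrbit_pvAnsatz`:
  `pvAnsatz α V` is classical Navier–Stokes on `(−∞,0)` with pressure `(−t)⁻¹Q(R(−αs)x/√−t)` and
  force `d(t,x) = (−t)^{−3/2} R(αs) G(R(−αs)x/√−t)`, `s = −log(−t)`. At `α = 0` this is the
  steady forced Leray reduction of `LerayLineRungProfile.lean` (p517517) again.
With `hband`/`hcob` from the tree (`AngularLadder.IsBandLimited.conj_linearIsometryEquiv`,
`.smul_comp_smul`; `FluidComputer/AngularGalerkinLadderRotation.lean`, `…Scaling.lean`) every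
hypothesis of `rungIsSingular_of_precessingLeray` (p518969) is now reduced to PROFILE data:
a smooth band-limited divergence-free `V ≢ 0` with `‖V(y)‖ ≤ C/(‖y‖+1)` solving the rotating steady
system with a co-band-limited defect `G` IS a singular rung — a K1 instance — and (p518969,
p524327) a window profile with the screw `rotZ(−2α log c)`, K2-capable exactly in Pineau–Vicol's
middle range of `α`.

LABEL: KERNEL (calculus). WHAT THIS IS NOT: not NS and not a K1 instance — no profile `V` is
constructed; no precessing root of any reduced system is known even numerically; no item moves.
References: [cite: PineauVicol2026, (1.7)–(1.9), Remark 1.2 (arXiv:2607.09619 pp. 3–4)];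
[cite: ChaeWolf2017RemovingDSS, §4]; [cite: Leray1934, §20 (3.11)–(3.12)].
-/

noncomputable section

namespace Summit.NavierStokesRegularity.AngularGalerkinLadderPrecessingReduction

open Set Function Filter Topology
open scoped Laplacian ContDiff
open Literature.Analysis.FluidPDE
open Summit.NavierStokesRegularity.FluidComputer
open Summit.NavierStokesRegularity.FluidComputer.AngularLadder

/-! ### §A Rotation calculus about the axis -/

/-- The generator `J v = (−v₁, v₀, 0)` is `e₃ × v`. [folklore] -/
theorem rotGen_eq_cross_axis (v : EuclideanSpace ℝ (Fin 3)) : rotGen v = cross (axis 2) v := by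
  ext i
  fin_cases i <;> simp [rotGen, cross, cross_apply, axis]

/-- The horizontal/vertical splitting used by `rotZ_eq_cos_sin`, as an identity of vectors. [folklore] -/
private theorem horiz_eq (x : EuclideanSpace ℝ (Fin 3)) :
    (WithLp.toLp 2 ![x 0, x 1, 0] : EuclideanSpace ℝ (Fin 3)) = x - x 2 • axis 2 := by
  ext i
  fin_cases i <;> simp [axis]

/-- The vertical part `(0, 0, x₂) = x₂ e₃`. [folklore] -/
private theorem vert_eq (x : EuclideanSpace ℝ (Fin 3)) :
    (WithLp.toLp 2 ![0, 0, x 2] : EuclideanSpace ℝ (Fin 3)) = x 2 • axis 2 := by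
  ext i
  fin_cases i <;> simp [axis]

/-- `J (R_θ x) = −sin θ (x₀, x₁, 0) + cos θ J x` — the angular derivative of `R_θ x`. [folklore] -/
theorem rotGen_rotZ_eq (θ : ℝ) (x : EuclideanSpace ℝ (Fin 3)) :
    rotGen (rotZ θ x) = -Real.sin θ • (x - x 2 • axis 2) + Real.cos θ • rotGen x := by
  ext i
  fin_cases i <;> simp [rotGen, rotZ, axis] <;> ring

/-- `R_θ x = cos θ (x − x₂e₃) + sin θ J x + x₂ e₃`. [folklore] -/
theorem rotZ_eq_cos_sin' (θ : ℝ) (x : EuclideanSpace ℝ (Fin 3)) :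
    rotZ θ x = Real.cos θ • (x - x 2 • axis 2) + Real.sin θ • rotGen x + x 2 • axis 2 := by
  rw [rotZ_eq_cos_sin, horiz_eq, vert_eq]

/-- **Chain rule for a rotating curve**: `d/ds R_{θ(s)} W(s) = θ′ J(R_θ W) + R_θ W′`. [folklore] -/
theorem hasDerivAt_rotZ_curve {θ : ℝ → ℝ} {θ' : ℝ} {W : ℝ → EuclideanSpace ℝ (Fin 3)}
    {W' : EuclideanSpace ℝ (Fin 3)} {s : ℝ} (hθ : HasDerivAt θ θ' s) (hW : HasDerivAt W W' s) :
    HasDerivAt (fun σ => rotZ (θ σ) (W σ))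
      (θ' • rotGen (rotZ (θ s) (W s)) + rotZ (θ s) W') s := by
  have hfun : (fun σ => rotZ (θ σ) (W σ)) = fun σ =>
      Real.cos (θ σ) • (W σ - (W σ) 2 • axis 2) + Real.sin (θ σ) • rotGen (W σ) + (W σ) 2 • axis 2 := by
    funext σ; exact rotZ_eq_cos_sin' _ _
  rw [hfun]
  have hc : HasDerivAt (fun σ => Real.cos (θ σ)) (-Real.sin (θ s) * θ') s :=
    (Real.hasDerivAt_cos _).comp s hθ
  have hsn : HasDerivAt (fun σ => Real.sin (θ σ)) (Real.cos (θ s) * θ') s :=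
    (Real.hasDerivAt_sin _).comp s hθ
  have h2 : HasDerivAt (fun σ => (W σ) 2) (W' 2) s :=
    ((EuclideanSpace.proj (2 : Fin 3)).hasFDerivAt.comp_hasDerivAt s hW :)
  have hH : HasDerivAt (fun σ => W σ - (W σ) 2 • axis 2) (W' - W' 2 • axis 2) s :=
    hW.sub (h2.smul_const _)
  have hJ : HasDerivAt (fun σ => rotGen (W σ)) (rotGen W') s := by
    have := (rotGenL.hasFDerivAt.comp_hasDerivAt s hW :)
    simpa only [rotGenL_apply, Function.comp_def] using this
  have hsum := ((hc.smul hH).add (hsn.smul hJ)).add (h2.smul_const (axis 2))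
  refine hsum.congr_deriv ?_
  rw [rotGen_rotZ_eq, rotZ_eq_cos_sin' (θ s) W']
  simp only [smul_add, smul_sub, smul_smul, mul_comm θ']
  module

/-! ### §B The precessing profile in similarity variables: time derivative and smoothness -/

/-- `rotZ` is linear (through the tree's `rotZL`). [folklore] -/
private theorem rotZ_smul' (θ a : ℝ) (z : EuclideanSpace ℝ (Fin 3)) : rotZ θ (a • z) = a • rotZ θ z := by
  rw [← rotZL_apply, map_smul, rotZL_apply]

/-- `rotZ` is additive (through the tree's `rotZL`). [folklore] -/
private theorem rotZ_sub' (θ : ℝ) (z w : EuclideanSpace ℝ (Fin 3)) :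
    rotZ θ (z - w) = rotZ θ z - rotZ θ w := by
  rw [← rotZL_apply, map_sub, rotZL_apply, rotZL_apply]

/-- **Time derivative of the precessing profile** `U(s, y) = R(αs) V(R(−αs) y)`:
`∂ₛU(s, y) = α · R(αs) (J₃V)(R(−αs) y)` with the ladder's own rotation generator
`J₃V = angGen 2 V = e₃ × V − DV[e₃ × ·]` (the Coriolis term of the co-precessing frame).
[cite: PineauVicol2026, (1.7) (arXiv:2607.09619 p. 3)] -/
theorem hasDerivAt_precessing {V : EuclideanSpace ℝ (Fin 3) → EuclideanSpace ℝ (Fin 3)}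
    (hV : Differentiable ℝ V) (α s : ℝ) (y : EuclideanSpace ℝ (Fin 3)) :
    HasDerivAt (fun σ => rotZ (α * σ) (V (rotZ (-(α * σ)) y)))
      (α • rotZ (α * s) (angGen 2 V (rotZ (-(α * s)) y))) s := by
  set z : EuclideanSpace ℝ (Fin 3) := rotZ (-(α * s)) y with hz
  -- inner curve
  have hθi : HasDerivAt (fun σ : ℝ => -(α * σ)) (-α) s := by
    have h := (hasDerivAt_id s).const_mul (-α)
    simp only [id_eq, neg_mul, mul_one] at h
    exact h
  have hin : HasDerivAt (fun σ => rotZ (-(α * σ)) y) ((-α) • rotGen z) s := by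
    have h := hasDerivAt_rotZ_curve (W := fun _ => y) hθi (hasDerivAt_const s y)
    simpa [hz, ← rotZL_apply] using h
  have hVz : HasDerivAt (fun σ => V (rotZ (-(α * σ)) y)) (fderiv ℝ V z ((-α) • rotGen z)) s :=
    ((hV z).hasFDerivAt.comp_hasDerivAt s hin :)
  -- outer rotation
  have hθo : HasDerivAt (fun σ : ℝ => α * σ) α s := by
    simpa using (hasDerivAt_id s).const_mul α
  have hout := hasDerivAt_rotZ_curve hθo hVz
  refine hout.congr_deriv ?_
  rw [rotGen_rotZ, map_smul, rotZ_smul', ← hz, angGen, ← rotGen_eq_cross_axis, ← rotGen_eq_cross_axis,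
    rotZ_sub']
  module

/-- The same, as the value of the tree's two-sided `timeDeriv`. [folklore] -/
theorem timeDeriv_precessing {V : EuclideanSpace ℝ (Fin 3) → EuclideanSpace ℝ (Fin 3)}
    (hV : Differentiable ℝ V) (α s : ℝ) (y : EuclideanSpace ℝ (Fin 3)) :
    timeDeriv (fun σ z => rotZ (α * σ) (V (rotZ (-(α * σ)) z))) s y =
      α • rotZ (α * s) (angGen 2 V (rotZ (-(α * s)) y)) := by
  rw [timeDeriv_apply, (hasDerivAt_precessing hV α s y).deriv]

/-- Joint smoothness of the precessing profile `(s, y) ↦ R(αs) V(R(−αs) y)`. [folklore] -/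
theorem contDiff_uncurry_precessing {V : EuclideanSpace ℝ (Fin 3) → EuclideanSpace ℝ (Fin 3)}
    {n : WithTop ℕ∞} (hV : ContDiff ℝ n V) (α : ℝ) :
    ContDiff ℝ n (uncurry fun (σ : ℝ) (z : EuclideanSpace ℝ (Fin 3)) => rotZ (α * σ) (V (rotZ (-(α * σ)) z))) := by
  have h1 : ContDiff ℝ n (fun p : ℝ × EuclideanSpace ℝ (Fin 3) => ((-(α * p.1)), p.2)) :=
    ((contDiff_fst.const_smul α).neg).prodMk contDiff_snd
  have h2 : ContDiff ℝ n (fun p : ℝ × EuclideanSpace ℝ (Fin 3) => rotZ (-(α * p.1)) p.2) :=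
    (contDiff_rotZ_uncurry.comp h1 :)
  have h3 : ContDiff ℝ n (fun p : ℝ × EuclideanSpace ℝ (Fin 3) => V (rotZ (-(α * p.1)) p.2)) :=
    hV.comp h2
  have h4 : ContDiff ℝ n (fun p : ℝ × EuclideanSpace ℝ (Fin 3) => (α * p.1, V (rotZ (-(α * p.1)) p.2))) :=
    (contDiff_fst.const_smul α).prodMk h3
  exact (contDiff_rotZ_uncurry.comp h4 :)

/-- Joint smoothness of the co-precessing pressure `(s, y) ↦ Q(R(−αs) y)`. [folklore] -/
theorem contDiff_uncurry_precessing_scalar {Q : EuclideanSpace ℝ (Fin 3) → ℝ} {n : WithTop ℕ∞}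
    (hQ : ContDiff ℝ n Q) (α : ℝ) :
    ContDiff ℝ n (uncurry fun (σ : ℝ) (z : EuclideanSpace ℝ (Fin 3)) => Q (rotZ (-(α * σ)) z)) := by
  have h1 : ContDiff ℝ n (fun p : ℝ × EuclideanSpace ℝ (Fin 3) => ((-(α * p.1)), p.2)) :=
    ((contDiff_fst.const_smul α).neg).prodMk contDiff_snd
  have h2 : ContDiff ℝ n (fun p : ℝ × EuclideanSpace ℝ (Fin 3) => rotZ (-(α * p.1)) p.2) :=
    (contDiff_rotZ_uncurry.comp h1 :)
  exact hQ.comp h2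

/-! ### §C The rotating steady Leray system ⇒ the forced backward Leray system for the precessing profile -/

/-- **The co-precessing frame.** If `V, Q ∈ C^∞` solve the ROTATING steady Leray system with defect
`G`, `−νΔV + ½V + ½(z·∇)V + α·J₃V + (V·∇)V + ∇Q = G`, `div V = 0` (`J₃ = angGen 2`), then the
precessing profile `U(s,y) = R(αs)V(R(−αs)y)` with pressure `Q(R(−αs)y)` is a classical solution
on all of `ℝ × ℝ³` of the backward Leray system (Leray drift) FORCED by the co-rotated defect
`R(αs)G(R(−αs)y)`. [cite: PineauVicol2026, (1.7)–(1.9) (arXiv:2607.09619 pp. 3–4)] -/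
theorem backwardLeray_precessing {ν α : ℝ}
    {V G : EuclideanSpace ℝ (Fin 3) → EuclideanSpace ℝ (Fin 3)} {Q : EuclideanSpace ℝ (Fin 3) → ℝ}
    (hV : ContDiff ℝ ∞ V) (hQ : ContDiff ℝ ∞ Q)
    (heq : ∀ z, -(ν • (Δ V) z) + (1 / 2 : ℝ) • V z + (1 / 2 : ℝ) • fderiv ℝ V z z +
      α • angGen 2 V z + convect V V z + gradient Q z = G z)
    (hdiv : VectorCalculus.IsDivFree V) :
    IsClassicalNSSolutionOn univ ν
      (fun s y => rescaledEulerLerayForce 1 (fun σ z => rotZ (α * σ) (V (rotZ (-(α * σ)) z))) s y +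
        rotZ (α * s) (G (rotZ (-(α * s)) y)))
      (fun σ z => rotZ (α * σ) (V (rotZ (-(α * σ)) z))) (fun σ z => Q (rotZ (-(α * σ)) z)) := by
  have hVd : Differentiable ℝ V := hV.differentiable (by simp)
  refine ⟨(contDiff_uncurry_precessing hV α).contDiffOn, (contDiff_uncurry_precessing_scalar hQ α).contDiffOn,
    fun s _ y => ?_, fun s _ => ?_⟩
  · -- the slice at time `s` is the conjugate of `V` by `R = rotZLIE (α s)`
    set R : EuclideanSpace ℝ (Fin 3) ≃ₗᵢ[ℝ] EuclideanSpace ℝ (Fin 3) := rotZLIE (α * s) with hRdef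
    have hslice : (fun z => rotZ (α * s) (V (rotZ (-(α * s)) z))) = fun z => R (V (R.symm z)) := by
      funext z; simp [hRdef]
    have hpress : (fun z => Q (rotZ (-(α * s)) z)) = fun z => Q (R.symm z) := by
      funext z; simp [hRdef]
    rw [timeDerivWithin_eq_deriv isOpen_univ (mem_univ s), (hasDerivAt_precessing hVd α s y).deriv]
    -- rewrite the slices
    rw [rescaledEulerLerayForce_apply]
    beta_reduce
    rw [hslice, hpress]
    rw [convect_conj_linearIsometryEquiv, laplacian_conj_linearIsometryEquiv,
      gradient_comp_linearIsometryEquiv_symm, fderiv_conj_linearIsometryEquiv]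
    set z : EuclideanSpace ℝ (Fin 3) := R.symm y with hz
    have hyz : rotZ (-(α * s)) y = z := by simp [hz, hRdef]
    have hRz : rotZ (α * s) = fun w => R w := by funext w; simp [hRdef]
    rw [hyz, hRz]
    simp only [ContinuousLinearMap.coe_comp, Function.comp_apply, LinearIsometryEquiv.coe_coe,
      ContinuousLinearEquiv.coe_coe]
    have key : α • angGen 2 V z + convect V V z =
        ν • (Δ V) z - gradient Q z + (-(((1 : ℝ) / 2) • (V z + fderiv ℝ V z z)) + G z) := by
      rw [← heq z]; module
    have := congrArg R key
    simpa only [map_add, map_sub, map_smul, map_neg] using this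
  · set R : EuclideanSpace ℝ (Fin 3) ≃ₗᵢ[ℝ] EuclideanSpace ℝ (Fin 3) := rotZLIE (α * s) with hRdef
    have hslice : (fun z => rotZ (α * s) (V (rotZ (-(α * s)) z))) = fun z => R (V (R.symm z)) := by
      funext z; simp [hRdef]
    show VectorCalculus.IsDivFree ((fun σ z => rotZ (α * σ) (V (rotZ (-(α * σ)) z))) s)
    rw [show (fun σ z => rotZ (α * σ) (V (rotZ (-(α * σ)) z))) s = fun z => R (V (R.symm z)) from hslice]
    exact hdiv.conj_linearIsometryEquiv R

/-! ### §D Back to physical variables: the precessing field is a classical FORCED solution -/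

/-- The pressure of the precessing field in physical variables, read in similarity variables. [folklore] -/
private theorem lerayOrbitPressure_precessing (α : ℝ) (Q : EuclideanSpace ℝ (Fin 3) → ℝ)
    (s : ℝ) (y : EuclideanSpace ℝ (Fin 3)) :
    lerayOrbitPressure (fun t x => (-t)⁻¹ * Q (rotZ (-(α * -Real.log (-t))) ((Real.sqrt (-t))⁻¹ • x))) s y =
      Q (rotZ (-(α * s)) y) := by
  simp only [lerayOrbitPressure]
  have he : (0 : ℝ) < Real.exp (-s) := Real.exp_pos _
  have hsq : Real.sqrt (Real.exp (-s)) = Real.exp (-s / 2) := by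
    rw [← exp_neg_half_sq, Real.sqrt_sq (Real.exp_pos _).le]
  have ha : Real.exp (-s / 2) ≠ 0 := (Real.exp_pos _).ne'
  rw [neg_neg, Real.log_exp, neg_neg, hsq, smul_smul, inv_mul_cancel₀ ha, one_smul, ← mul_assoc,
    mul_inv_cancel₀ he.ne', one_mul]

/-- The defect of the precessing field in physical variables, read in similarity variables. [folklore] -/
private theorem lerayOrbitForce_precessing (α : ℝ) (G : EuclideanSpace ℝ (Fin 3) → EuclideanSpace ℝ (Fin 3))
    (s : ℝ) (y : EuclideanSpace ℝ (Fin 3)) :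
    lerayOrbitForce (fun t x => (Real.sqrt (-t))⁻¹ ^ 3 •
        rotZ (α * -Real.log (-t)) (G (rotZ (-(α * -Real.log (-t))) ((Real.sqrt (-t))⁻¹ • x)))) s y =
      rotZ (α * s) (G (rotZ (-(α * s)) y)) := by
  simp only [lerayOrbitForce_apply]
  have hsq : Real.sqrt (Real.exp (-s)) = Real.exp (-s / 2) := by
    rw [← exp_neg_half_sq, Real.sqrt_sq (Real.exp_pos _).le]
  have ha : Real.exp (-s / 2) ≠ 0 := (Real.exp_pos _).ne'
  rw [neg_neg, Real.log_exp, neg_neg, hsq, smul_smul, smul_smul, ← mul_pow, mul_inv_cancel₀ ha,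
    one_pow, one_smul, inv_mul_cancel₀ ha, one_smul]

/-- **The forced ROTATING Leray reduction.** If `V, Q ∈ C^∞` solve the rotating steady Leray
system with defect `G` — `−νΔV + ½V + ½(z·∇)V + α·J₃V + (V·∇)V + ∇Q = G`, `div V = 0`,
`J₃ = AngularLadder.angGen 2` — then Pineau–Vicol's precessing field `u = pvAnsatz α V`
(`u(t,x) = (−t)^{-1/2} R(αs) V(R(−αs) x/√−t)`, `s = −log(−t)`) is a classical Navier–Stokes
solution with viscosity `ν` on `(−∞, 0) × ℝ³` with pressure `(−t)⁻¹ Q(R(−αs)x/√−t)` FORCED by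
`d(t,x) = (−t)^{-3/2} R(αs) G(R(−αs) x/√−t)` (the co-precessing, Leray-scaled defect). This
discharges the hypothesis `hcl` of `PrecessingLerayLineRungProfile.rungIsSingular_of_precessingLeray`
(p518969); `hband`/`hcob` there follow from the tree's
`AngularLadder.IsBandLimited.conj_linearIsometryEquiv` / `.smul_comp_smul` (FluidComputer).
[cite: PineauVicol2026, (1.7)–(1.9) (arXiv:2607.09619 pp. 3–4)] [cite: Leray1934, §20 (3.11)–(3.12)] -/
theorem isClassicalNSSolutionOn_pvAnsatz_forced {ν α : ℝ}
    {V G : EuclideanSpace ℝ (Fin 3) → EuclideanSpace ℝ (Fin 3)} {Q : EuclideanSpace ℝ (Fin 3) → ℝ}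
    (hV : ContDiff ℝ ∞ V) (hQ : ContDiff ℝ ∞ Q)
    (heq : ∀ z, -(ν • (Δ V) z) + (1 / 2 : ℝ) • V z + (1 / 2 : ℝ) • fderiv ℝ V z z +
      α • angGen 2 V z + convect V V z + gradient Q z = G z)
    (hdiv : VectorCalculus.IsDivFree V) :
    IsClassicalNSSolutionOn (Iio 0) ν
      (fun t x => (Real.sqrt (-t))⁻¹ ^ 3 •
        rotZ (α * -Real.log (-t)) (G (rotZ (-(α * -Real.log (-t))) ((Real.sqrt (-t))⁻¹ • x))))
      (pvAnsatz α (fun y _ => V y))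
      (fun t x => (-t)⁻¹ * Q (rotZ (-(α * -Real.log (-t))) ((Real.sqrt (-t))⁻¹ • x))) := by
  rw [AngularGalerkinLadderRungSimilarity.isClassicalNSSolutionOn_Iio_iff_backwardLeray_forced]
  have hU : lerayOrbit (pvAnsatz α (fun y _ => V y)) =
      fun σ z => rotZ (α * σ) (V (rotZ (-(α * σ)) z)) := by
    funext σ z; rw [PineauVicol2026.lerayOrbit_pvAnsatz]
  have hP : lerayOrbitPressure (fun t x => (-t)⁻¹ * Q (rotZ (-(α * -Real.log (-t))) ((Real.sqrt (-t))⁻¹ • x))) =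
      fun σ z => Q (rotZ (-(α * σ)) z) := by
    funext σ z; exact lerayOrbitPressure_precessing α Q σ z
  have hF : lerayOrbitForce (fun t x => (Real.sqrt (-t))⁻¹ ^ 3 •
        rotZ (α * -Real.log (-t)) (G (rotZ (-(α * -Real.log (-t))) ((Real.sqrt (-t))⁻¹ • x)))) =
      fun σ z => rotZ (α * σ) (G (rotZ (-(α * σ)) z)) := by
    funext σ z; exact lerayOrbitForce_precessing α G σ z
  have h := backwardLeray_precessing (ν := ν) (α := α) hV hQ heq hdiv
  rw [hU, hP]
  refine h.congr_force ?_
  · intro σ _ z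
    simp only [hF]

end Summit.NavierStokesRegularity.AngularGalerkinLadderPrecessingReduction

end
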